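import Summits.BirchSwinnertonDyer.BirchSwinnertonDyer.Theorems.ByReductionTypeAtTwoOrdKatoHalfAtTwoIsoSignFreeDefs
import Summits.BirchSwinnertonDyer.BirchSwinnertonDyer.Theorems.ByReductionTypeAtTwoOrdKatoHalfAtTwoIsoOmegaRoadDefs
import Summits.BirchSwinnertonDyer.BirchSwinnertonDyer.Theorems.ByReductionTypeAtTwoOrdKatoHalfAtTwoIsoSelmerSideTwo
import Summits.BirchSwinnertonDyer.BirchSwinnertonDyer.Theorems.ByReductionTypeAtTwoOrdKatoHalfAtTwoIsoChebotarevTranspositionPosDisc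
import Summits.BirchSwinnertonDyer.BirchSwinnertonDyer.Theorems.ByReductionTypeAtTwoOrdKatoHalfAtTwoIsoKolyvaginRankOnePosDisc
import HarnessLib

/-!
# Route ByReductionTypeAtTwo, crux `OrdKatoHalfAtTwoIso` (stmt-BirchSwinnertonDyer-19573), line `steinberg-fibre-at-two`
# (skeleton v11): the registered stub `stub_coreA_posDisc : CoreTheoremAPosDiscTwo` PROVED — the core Theorem A at `2`
# AT THE REAL PLACE (`0 < Δ`) — and the route child `OrdKatoIntSurjectiveAtTwo` (stmt-BirchSwinnertonDyer-23967) CLOSED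

Seat `cruxlead-stmt-BirchSwinnertonDyer-19573-w2` (prover WIDTH under the lead cruxlead-19573 g5; HOME
`run/shared/lean/pub/bsd-2adic/`). THEOREMS ONLY (no definition, no named fact, no `sorry`, no instance). HONEST FRAMING
(cell bsd-2adic): BSD is not proved by any of this; the CRUX `OrdKatoHalfAtTwoIso` is NOT proved here (it stays
conditional on its other children F1μ⁺ 23959, B7′ 23921 and the print bundle 23889 via the glue 23763). What IS proved
unconditionally is the research child CoreA⁺ = `CoreTheoremAPosDiscTwo` (p684479, lead g5): for `W/ℚ` globally minimal,
good at `2`, `a₂` odd, `ρ̄_{W,2}` onto, `0 < Δ_W`, cyclotomic `(κ, γ)` and Kato's `𝐇¹_Γ(T₂W)`, a genuine `2`-adic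
Euler-system class `s ∉ 2·𝐇¹` kills the `E[2]`-lifts of `Sel₀(E/ℚ_∞)` by a power of `T`.

PROOF = the `0 < Δ` twin of the Ω-road composition `coreTwoResidue_of_rankOne` (p658966; the `Δ < 0` half is the THEOREM
`coreTheoremATwoResidue_holds`, p669276) over

* T1 `stub_T1_selmerSideTwo` (p663770; sign-free),
* (H-C)⁺ `chebotarevTransposition_two_posDisc` (this seat, `…ChebotarevTranspositionPosDisc.lean`: the transposition prime
  with `4 ∣ ℓ(q) − 1`, Rubin's `τ` p682874 + the index-2 descent of the Steinberg–Sah input),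
* (H-K)⁺ `kolyvaginRankOne_two_posDisc` (this seat, `…KolyvaginRankOnePosDisc.lean`: p668150's assembly over the lead's
  real-zero Kolyvagin package p688788 — built on the cocycle-level vanishing of the Kolyvagin class at complex conjugation
  for `ℓ ≡ 1 (mod 4)`, p688002 / p687675 / p687273, and the coset bookkeeping p687566 — and Step 4 `…_of_xinf`, p685843),
* the two TREE facts `Kato2004.mem_pSmul_of_red_eq_zero_holds` (Kato §13.8 on the pin) and
  `poitouTate_sum_localTatePairing_eq_zero_holds ℚ`, and the count `convCoeff_zero_one_eq_zero_of_reciprocity`.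

MEMO-6's archimedean factor `c_∞ = 2` in kernel form: the real component of the Kolyvagin class of a prime `q ≡ 1 (mod 4)`
vanishes, so the reciprocity law runs at `0 < Δ` exactly as at `Δ < 0`.

Contents: `coreTheoremAPosDiscTwo_of_rankOne` (the composition, conditional on the two tree facts and T1 as hypotheses) ·
`coreTheoremAPosDiscTwo_holds` · `stub_coreA_posDisc` (the registered stub header of skeleton v11) ·
`ordKatoIntSurjectiveAtTwo_proof : Summit.….Theses.ByReductionTypeAtTwo.OrdKatoIntSurjectiveAtTwo` (the route child after
P7 is VERBATIM `CoreTheoremAPosDiscTwo`; closes stmt-BirchSwinnertonDyer-23967) · §2 the lead's sign-free doors (p684479) with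
CoreA⁺ DISCHARGED: `μ = 0` and the old B8 from F1μ⁺ + print, and the CRUX BY NAME from {F1μ⁺ 23959, bundle 23889, B7′ 23921}
(all three remain OPEN binders — conditional results, nothing asserted about them).

References: B. Mazur, K. Rubin, Mem. AMS 799 (2004) Prop. 1.3.2, §§3, 5.3 [MazurRubin2004]; K. Kato, Astérisque 295 (2004)
Thm. 12.6, §13.8 [Kato2004Asterisque]; K. Rubin, *Euler Systems* (2000) §2.1, §4.4–4.5 [Rubin2000]; J. S. Milne, *ADT*
(2006) I Thm. 4.10 [MilneADT2006]; HOME memo MEMO-6 (c_∞ = 2); the lead's `STUB-BRIEF-stub_coreA_posDisc.md` + addenda.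
-/

set_option autoImplicit false
set_option linter.dupNamespace false

noncomputable section

open scoped Classical MatrixGroups ModularForm NumberField
open CongruenceSubgroup WeierstrassCurve Field IsDedekindDomain NumberField
open Literature.NumberTheory.GaloisRepresentations
open Literature.NumberTheory.GaloisCohomology
open Literature.NumberTheory.EllipticCurves Literature.NumberTheory.EllipticCurves.ModularForms
open Literature.NumberTheory.EllipticCurves.Kato2004
open Literature.NumberTheory.EllipticCurves.Kato2004.EulerSystemValues
open Literature.NumberTheory.EllipticCurves.Rank1Residual
open Literature.NumberTheory.EllipticCurves.Greenberg1999
open Summit.BirchSwinnertonDyer.Rank1Residual Summit.BirchSwinnertonDyer.Rank1Residual.X5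
open Summit.BirchSwinnertonDyer.BirchSwinnertonDyer.Theorems.OrdKatoOptimalAtTwo
  Summit.BirchSwinnertonDyer.BirchSwinnertonDyer.Theorems.OrdKatoIntAtTwo
open Summit.BirchSwinnertonDyer.BirchSwinnertonDyer.Theses.ByReductionTypeAtTwo
open Summit.BirchSwinnertonDyer.BirchSwinnertonDyer.Rank1Residual
open Summit.BirchSwinnertonDyer.BirchSwinnertonDyer.Rank1Residual.CoreAssembly

namespace Summit.BirchSwinnertonDyer.BirchSwinnertonDyer.Theorems.SteinbergFibreAtTwo

/-- **`CoreTheoremAPosDiscTwo` from the Ω road at the real place** — the `0 < Δ` twin of `coreTwoResidue_of_rankOne`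
(p658966): Step 0 (tree) + T1 (`hG1`) + (H-C)⁺ + (H-K)⁺ + the count, given Kato §13.8 on the pin (`hred`) and
Poitou–Tate over `ℚ` (`hPT`). Verbatim the Δ<0 composition with the transposition prime taken `≡ 1 (mod 4)`
(`chebotarevTransposition_two_posDisc`) and the reciprocity law `kolyvaginRankOne_two_posDisc`.
[cite: MazurRubin2004, Prop. 1.3.2 and §5.3] [cite: Kato2004Asterisque, §13.8 (pp. 228–229)] -/
theorem coreTheoremAPosDiscTwo_of_rankOne (hred : mem_pSmul_of_red_eq_zero)
    (hPT : poitouTate_sum_localTatePairing_eq_zero ℚ) (hG1 : SelmerSideTwo) : CoreTheoremAPosDiscTwo := by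
  intro W _ _ _ _ _ κ γ I hκ hgood _ h2 hΔ hγ hs
  obtain ⟨s, hES, hsp⟩ := hs
  have hirr : W.HasIrreducibleModPGaloisRep 2 := hasIrreducibleModPGaloisRep_of_hasSurjectiveModNGaloisRep W 2 h2
  -- STEP 0 (tree, any prime): `red_Ω s = T^a κ'`, `κ̄' ≠ 0`
  have ht : I.redTower s ≠ 0 := I.redTower_ne_zero_of_not_mem hred hκ hγ hsp
  obtain ⟨a, κ', hκ'a, -, hκ'c⟩ :=
    LevelE.exists_towerShift_iterate_eq_and_towerConst_ne_zero W 2 κ hirr ht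
  -- Steps 3–4 (H-K)⁺: the bad set `S₀`; the Selmer side (T1): `ε`, `S₁ ⊇ S₀`
  obtain ⟨S₀, hS₀, hK'⟩ := kolyvaginRankOne_two_posDisc W κ γ I hκ h2 hΔ hγ hPT s hES
  obtain ⟨ε, S₁, hS₁, hS₀₁, hG1'⟩ := hG1 W κ γ h2 hκ hγ S₀ hS₀
  -- a Weil pairing on `E[2]`
  obtain ⟨eW, hμ, hadd₁, hadd₂, halt, hnondeg, hgal⟩ := W.exists_weilPairing_holds 2 le_rfl (by norm_num)
  -- suppose the conclusion fails; level `J = e + 1 = a + ε + 2`, depth `n := e + 1` (`J ≤ 2^n`)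
  by_contra hcon
  push Not at hcon
  set e : ℕ := a + ε + 1 with he
  have hJn : e + 1 ≤ 2 ^ (e + 1) := (Nat.lt_pow_self (by norm_num)).le
  obtain ⟨y, hy, hyT⟩ := hcon e
  obtain ⟨Ψ, hΨT, hΨur, hΨε⟩ := hG1' e y hy hyT
  obtain ⟨Ψc, hΨc⟩ := oneCocycleClass_surjective _ Ψ
  subst hΨc
  obtain ⟨Φ, hΦ⟩ := oneCocycleClass_surjective _ (κ'.1 (e + 1))
  -- STEPS 1+2 (H-C)⁺: a transposition prime `q ∉ S₁`, `q ≡ 1 (mod 4)`, of depth `≥ e + 1`, non-degenerate bottom pairing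
  obtain ⟨q, hq, 𝔓, h𝔓, Fr, hFr, hFr1, hFr2, hFrn, h4, hne⟩ :=
    chebotarevTransposition_two_posDisc W κ γ h2 hgood hΔ hκ hγ κ' hκ'c e Φ hΦ Ψc hΨT eW hμ hadd₁ hadd₂ halt hnondeg
      hgal S₁ hS₁ (e + 1)
  -- STEPS 3–4 (H-K)⁺: the Kolyvagin class of `q` and reciprocity (real term killed since `4 ∣ ℓ(q) − 1`)
  obtain ⟨U, hU0, hrec⟩ := hK' a κ' hκ'a (e + 1) (e + 1) hJn Φ hΦ ε S₁ _ Ψc hS₀₁ rfl hΨur hΨε eW hμ hadd₁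
    hadd₂ halt hnondeg hgal q hq 𝔓 h𝔓 Fr hFr hFr1 hFr2 hFrn h4
  -- the count (tree): `C_0 = 0` for the pair `(N Φ(Fr), Ψc(Fr))`
  have hpC : ∀ c : DiscreteGaloisModule.MuCarrier ℚ 2, ((2 : ℕ) : ℤ) • c = 0 :=
    natCast_zsmul_muCarrier_eq_zero ℚ 2
  obtain ⟨hC0, -⟩ := convCoeff_zero_one_eq_zero_of_reciprocity (weilPairingHom W 2 eW hμ hadd₁ hadd₂)
    Nat.prime_two hpC (m := a) (ε := ε) (by omega) U hU0 _ (Ψc.1 Fr) hrec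
  rw [convCoeff_zero_eq _ (by omega), Pi.sub_apply, modPTwist_apply_zero] at hC0
  exact hne hC0

/-- **THE CORE THEOREM A AT `2` AT THE REAL PLACE, PROVED**: `CoreTheoremAPosDiscTwo` (p684479) — the `0 < Δ` twin of the
line's socket 1 — from the composition above with the two tree facts (`mem_pSmul_of_red_eq_zero_holds`,
`poitouTate_sum_localTatePairing_eq_zero_holds ℚ`, both proved at `p = 2`) and T1 (`stub_T1_selmerSideTwo`, p663770).
[cite: MazurRubin2004, Prop. 1.3.2 and §3.6] [cite: Kato2004Asterisque, Thm. 12.6 (p. 222) and §13] -/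
theorem coreTheoremAPosDiscTwo_holds : CoreTheoremAPosDiscTwo :=
  coreTheoremAPosDiscTwo_of_rankOne mem_pSmul_of_red_eq_zero_holds (poitouTate_sum_localTatePairing_eq_zero_holds ℚ)
    stub_T1_selmerSideTwo

/-- **Registered stub `stub_coreA_posDisc` of skeleton v11 (line steinberg-fibre-at-two), PROVED.**
[cite: MazurRubin2004, Prop. 1.3.2 and §3.6] [cite: Kato2004Asterisque, §13.8 (pp. 228–229)] -/
theorem stub_coreA_posDisc : CoreTheoremAPosDiscTwo :=
  coreTheoremAPosDiscTwo_holds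

/-- **The route child `OrdKatoIntSurjectiveAtTwo` (stmt-BirchSwinnertonDyer-23967) — after the P7 sign-free re-cut its
text is VERBATIM the body of `CoreTheoremAPosDiscTwo` («the core Theorem A at 2 at the real place») — PROVED.**
[cite: MazurRubin2004, Prop. 1.3.2 and §3.6] [cite: Kato2004Asterisque, Thm. 12.6 (p. 222) and §13.8] -/
theorem ordKatoIntSurjectiveAtTwo_proof :
    Summit.BirchSwinnertonDyer.BirchSwinnertonDyer.Theses.ByReductionTypeAtTwo.OrdKatoIntSurjectiveAtTwo := by
  unfold Summit.BirchSwinnertonDyer.BirchSwinnertonDyer.Theses.ByReductionTypeAtTwo.OrdKatoIntSurjectiveAtTwo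
  exact coreTheoremAPosDiscTwo_holds

/-! ## §2 Consumers with CoreA⁺ DISCHARGED: what the remaining children F1μ⁺ + print (+ B7′) now give BY NAME -/

/-- **μ(X(E/ℚ_∞)) = 0 on «good ordinary at 2, ρ̄₂ onto» from F1μ⁺ ALONE** (the lead's `mu_eq_zero_of_signFree` with its
CoreA⁺ hypothesis discharged by `coreTheoremAPosDiscTwo_holds`). Conditional on the memo-tier binder `ZetaColemanMuInputsAtTwo`
(child 23959); nothing asserted about it. [cite: Kato2004Asterisque, Thm. 12.6 (p. 222) and §13.8]
[cite: GreenbergLNM1716, §4 (μ-invariant)] -/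
theorem mu_eq_zero_of_zetaColemanMuInputsAtTwo (hZ : ZetaColemanMuInputsAtTwo)
    (W : WeierstrassCurve ℚ) [W.IsElliptic] [W.IsGloballyMinimal]
    (hgo : GoodOrd W 2) (h2 : W.HasSurjectiveModNGaloisRep 2)
    {N : ℕ} [NeZero N] (f : CuspForm (Gamma0 N) 2) (hf : IsNewformOf W f)
    (κ : ZpExtension ℚ 2) (γ : absoluteGaloisGroup ℚ) (hκ : κ.IsCyclotomic) (hγ : κ.IsTopGenerator γ)
    (hγ' : IsCyclotomicVariable 2 γ) (D : W.SelmerDualData κ γ) : D.mu = 0 :=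
  mu_eq_zero_of_signFree hZ coreTheoremAPosDiscTwo_holds W hgo h2 f hf κ γ hκ hγ hγ' D

/-- **The OLD B8 `KatoIntAtGoodOrdSurjectiveTwo` (the pre-P7 text of child 23762: Kato's lower divisibility at `W` for
`ρ_{W,2^∞}` onto) from F1μ⁺ + Abbes–Ullmo + Kato 17.4 (1)(2)** — the lead's `katoIntAtGoodOrdSurjectiveTwo_of_signFree`
with CoreA⁺ discharged. Conditional on `ZetaColemanMuInputsAtTwo` (memo tier) and the two print facts.
[cite: Kato2004Asterisque, Thm. 17.4 (p. 273)] [cite: AbbesUllmo1996, Thm. A] -/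
theorem katoIntAtGoodOrdSurjectiveTwo_of_zetaColemanMuInputsAtTwo (hZ : ZetaColemanMuInputsAtTwo)
    (hAU : abbesUllmo_not_dvd_maninConstant_of_not_dvd_level)
    (h17 : ∀ (V : WeierstrassCurve ℚ) [V.IsElliptic] [V.IsGloballyMinimal] [NeZero (V.conductorNorm ℤ)]
      (f : CuspForm (Gamma0 (V.conductorNorm ℤ)) 2), kato_divisibility_allPrimes V 2 (f := f)) :
    KatoIntAtGoodOrdSurjectiveTwo :=
  katoIntAtGoodOrdSurjectiveTwo_of_signFree hZ coreTheoremAPosDiscTwo_holds hAU h17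

/-- **The CRUX `OrdKatoHalfAtTwoIso` from its THREE remaining children BY NAME** — F1μ⁺ (23959 `ZetaColemanMuInputsAtTwo`),
the print bundle (23889: PUB ∧ Abbes–Ullmo ∧ Greenberg Prop. 5.14 at 2) and B7′ (23921
`KatoMuPartOff514AtOptimalMemberOfNotSurjectiveTwo`) — the lead's `ordKatoHalfAtTwoIso_of_signFree_cite` with CoreA⁺
discharged. CONDITIONAL on those three (memo / print); nothing asserted about them.
[cite: Kato2004Asterisque, Thm. 17.4 (1)(2) (p. 273)] [cite: AbbesUllmo1996, Thm. A] -/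
theorem ordKatoHalfAtTwoIso_of_zetaColemanMuInputsAtTwo_cite (hZ : ZetaColemanMuInputsAtTwo)
    (hB : OrdPublishedInputsAtTwo ∧ abbesUllmo_not_dvd_maninConstant_of_not_dvd_level ∧
      prop514_isTorsion_mu_eq_zero_two)
    (hB7' : KatoMuPartOff514AtOptimalMemberOfNotSurjectiveTwo) : OrdKatoHalfAtTwoIso :=
  ordKatoHalfAtTwoIso_of_signFree_cite hZ coreTheoremAPosDiscTwo_holds hB hB7'

/-- The same with the un-split B7 `KatoMuPartAtOptimalMemberOfNotSurjectiveTwo` (insurance branch of the glue).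
[cite: Kato2004Asterisque, Thm. 17.4 (1)(2) (p. 273)] [cite: AbbesUllmo1996, Thm. A] -/
theorem ordKatoHalfAtTwoIso_of_zetaColemanMuInputsAtTwo_cite_B7 (hZ : ZetaColemanMuInputsAtTwo)
    (hB : OrdPublishedInputsAtTwo ∧ abbesUllmo_not_dvd_maninConstant_of_not_dvd_level ∧
      prop514_isTorsion_mu_eq_zero_two)
    (hB7 : KatoMuPartAtOptimalMemberOfNotSurjectiveTwo) : OrdKatoHalfAtTwoIso :=
  ordKatoHalfAtTwoIso_of_signFree_cite_B7 hZ coreTheoremAPosDiscTwo_holds hB hB7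

end Summit.BirchSwinnertonDyer.BirchSwinnertonDyer.Theorems.SteinbergFibreAtTwo

end
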